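/-
COR-CM (cell pub-hodgecm2, stage 2 of the Hodge ladder) — count-neutral kernel census (seat prover-pub-hodgecm2-b23-g37-0, binder
prover b23, gen 37; claim EVEN-SLICE F2, HOME/INBOX.md 2026-08-22T13:48Z; sequel of `Census/EvenSliceFacesDescent.lean`).  Two
bookkeeping definitions (`sgn`, `sgnFun` — the sign functional) + theorems, in seat b09's representative-free model of the faithful full
slice of `(ℤ/2 × A, (1,0))` (`Census/OddSliceFacesModel|Squares|Descent|Count.lean`, consumed BY NAME; nothing of b09's is restated or
re-filed); no `decide` table, no certificate, no named fact, no geometry, no `sorry`.  `Interfaces.lean` (C1), every E term, B01 and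
`Transposition/*` are untouched.  HC_CM is NOT proved anywhere in this cell; nothing here is a headline and nothing here produces a
period.
-/
import Summits.HodgeConjecture.CorCM.Census.EvenSliceFacesDescent
import Summits.HodgeConjecture.CorCM.Census.OddSliceFacesCount
import Mathlib.GroupTheory.Perm.Cycle.Type

/-!
# Faces generate the Hodge lattice of the faithful full slice of `(ℤ/2 × A, (1,0))`, `|A|` EVEN: the canonical squares ALONE generate

THE THEOREM (**`hodge_le_pairs_sup_spanFaces_squares_of_even`**).  For every finite abelian group `A` of EVEN order, in seat b09's
representative-free model of the faithful full slice of the Galois CM type `(ℤ/2 × A, (1,0))` (`G = ℤ/2 × A`, `c = (1,0)`; these are the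
Galois CM fields `k·F₀`, `k` imaginary quadratic, `F₀` totally real with abelian group `A` — among them every cyclotomic field `ℚ(ζ_N)`
with `4 ∣ N`, and `ℚ(ζ_N)` for `N` odd with a prime factor `≡ 3 (mod 4)` and `φ(N)/2` even), the Hodge lattice is generated, together
with the divisor pairs, by the Galois translates of the classes of the CANONICAL SQUARES alone:
  `hodge A ≤ pairs A ⊔ spanFaces A (squares A)`,  `|squares A| + 1 = #OrbitsA A`  (`card_squares_add_one`)
— one rank-four face per simple factor other than `E` and other than the single-defect factor `B₁`.  So the least number of Galois
orbits of Hodge generators modulo divisor classes is AT MOST `#(simple factors ≠ E) − 1`, attained by rank-four faces; seat b09's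
block-parity floor (`CorCM/FaceParityFloor.lean` `card_block_le_card_add_of_hgen`: `β ≤ |𝒮| + 1 + δ`, and `δ = 1` here because every
element of `ℤ/2 × A` has order dividing `|A|`) is the matching lower bound `β − 2 = #OrbitsA A − 1`.  Values: `(ℤ/2)³ 3`,
`ℤ/4 × ℤ/2 (c ∉ 2G) 2`, `ℤ/6 × ℤ/2 6` (the landed census minima), `ℤ/2 × ℤ/8 18`, `ℤ/2 × ℤ/2 × ℤ/4 22`, `(ℤ/2)⁴ 28`, `ℤ/2 × ℤ/10 54`,
`ℤ/2 × ℤ/12 178`, `(ℤ/2)² × ℤ/6 188`.  Contrast: for `|A|` ODD the squares do NOT suffice and seat b09 adjoins one closing face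
(`Census/OddSliceFacesGenerate.lean`, `μ = #OrbitsA A` by seat b17's `oddSlice_law`).

PROOF (kernel).  Part F1 (`EvenSliceFacesDescent`, parity-free): `hodge ≤ (pairs ⊔ ℤ[G]·squares) ⊔ ℤ·weil`.  It remains to show
**`weil_mem_of_even`**: `weil ∈ pairs ⊔ ℤ[G]·squares` when `|A|` is even.  (1) THE SIGN FUNCTIONAL `sgnFun m = Σ_ψ sgn(ψ) m(ψ)`,
`sgn = +1 / −1 / 0` on labels of weight `< |A|/2`, `> |A|/2`, `= |A|/2`: it kills the pairs, is `±`-invariant under `G`, KILLS every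
face through two defects of a type of weight `< |A|/2` (signs `+, −, −, +`), takes the value `−1` on a face through two defects of a
type of weight `= |A|/2` (signs `0, −, −, +`) and the value `2` on `weil` (`|A| ≥ 3`).  (2) AN ANTI-PERIODIC TYPE: `|A|` even ⇒ `A`
has an element `t` of order `2` (Cauchy) ⇒ there is a type `ψ₀` with `tw (0,t) ψ₀ = ψ₀ + 1` (`exists_antiperiodic`: order the elements
of `A` and put `ψ₀ s = 0` iff `s` precedes `s + t`), necessarily of weight `|A|/2`; the normalised representative `ρ₀` of its simple
factor is anti-periodic too.  (3) Let `s = (ρ₀; i, j)` be the canonical square of that factor and `s' = (ρ₀ + 1; i − t, j − t)` its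
`(0,t)`-translate; `s + s' − (e_{ρ₀} + e_{ρ₀+1})` is a Hodge vector supported in defect class `≤ |A|/2 − 1`, so by the descent of part
F1 WITH CLASS BOUND `|A|/2 − 1` it is `≡ ρ·weil` modulo pairs and translates of squares of weight `≤ |A|/2 − 1`, all killed by
`sgnFun`; evaluating, `−1 − 1 − 0 = 2ρ`, so `ρ = −1` and `weil ∈ pairs ⊔ ℤ[G]·squares`.  For `|A| = 2` (`squares = ∅`), `weil` is the
pair through `δ 0` (`weil_mem_pairs_of_card_eq_two`).  All [folklore].

## References
* [Pohlmann1968] H. Pohlmann, Algebraic cycles on abelian varieties of complex multiplication type, Ann. of Math. 88 (1968), Thm 1.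
* [Milne1999] J. S. Milne, Lefschetz motives and the Tate conjecture, Compositio Math. 117 (1999), Prop. 2.1, p. 54.
* [Weil1977HodgeRing] A. Weil, Abelian varieties and the Hodge ring, Œuvres Scientifiques III, [1977c], 421–429.
-/

namespace Summit.HodgeConjecture.CorCM.Census.EvenSliceFacesGenerate

open Finset
open Summit.HodgeConjecture.CorCM.Census.OddSliceFacesModel
open Summit.HodgeConjecture.CorCM.Census.OddSliceFacesSquares
open Summit.HodgeConjecture.CorCM.Census.OddSliceFacesDescent
open Summit.HodgeConjecture.CorCM.Census.OddSliceFacesCount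
open Summit.HodgeConjecture.CorCM.Census.EvenSliceFacesDescent

variable (A : Type) [AddCommGroup A] [Fintype A] [DecidableEq A]

/-! ## §1 The sign functional -/

/-- The sign of a label: `+1` if its weight is `< |A|/2`, `−1` if `> |A|/2`, `0` if `= |A|/2`. [folklore] -/
def sgn (ψ : Ty A) : ℤ :=
  if 2 * wt A ψ < Fintype.card A then 1 else if Fintype.card A < 2 * wt A ψ then -1 else 0

/-- **The sign functional** `sgnFun m = Σ_ψ sgn(ψ) m(ψ)`. [folklore] -/
def sgnFun : (Ty A → ℤ) →ₗ[ℤ] ℤ where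
  toFun m := sgn A ⬝ᵥ m
  map_add' m m' := dotProduct_add _ _ _
  map_smul' c m := by
    show sgn A ⬝ᵥ (c • m) = c • (sgn A ⬝ᵥ m)
    exact dotProduct_smul c (sgn A) m

omit [AddCommGroup A] in
/-- `sgnFun` on a unit vector. [folklore] -/
theorem sgnFun_single (ψ : Ty A) (c : ℤ) : sgnFun A (Pi.single ψ c) = sgn A ψ * c := by
  show sgn A ⬝ᵥ Pi.single ψ c = sgn A ψ * c
  rw [dotProduct_single]

omit [AddCommGroup A] [DecidableEq A] in
/-- Sign of the conjugate: `sgn (ψ + 1) = −sgn ψ` (any `|A|`). [folklore] -/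
theorem sgn_add_one (ψ : Ty A) : sgn A (ψ + 1) = -sgn A ψ := by
  have hw := wt_le A ψ
  unfold sgn
  rw [wt_add_one]
  split_ifs <;> omega

omit [DecidableEq A] in
/-- Sign is invariant under `(0,t)`-twists. [folklore] -/
theorem sgn_tw_zero (t : A) (ψ : Ty A) : sgn A (tw A (0, t) ψ) = sgn A ψ := by
  unfold sgn; rw [wt_tw_zero]

omit [DecidableEq A] in
/-- Sign of a twist: `± sgn`. [folklore] -/
theorem sgn_tw (g : ZMod 2 × A) (ψ : Ty A) : sgn A (tw A g ψ) = (if g.1 = 0 then 1 else -1) * sgn A ψ := by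
  obtain ⟨a, t⟩ := g
  have h01 : ∀ u : ZMod 2, u = 0 ∨ u = 1 := by decide
  rcases h01 a with rfl | rfl
  · rw [sgn_tw_zero]; simp
  · rw [tw_one, sgn_add_one, sgn_tw_zero]; simp

omit [AddCommGroup A] in
/-- `sgnFun` kills the pairs. [folklore] -/
theorem sgnFun_pairVec (ψ : Ty A) : sgnFun A (pairVec A ψ) = 0 := by
  unfold pairVec
  rw [map_add, sgnFun_single, sgnFun_single, sgn_add_one]
  ring

/-- `sgnFun` changes at most by a sign under Galois translation. [folklore] -/
theorem sgnFun_transl (g : ZMod 2 × A) (v : Ty A → ℤ) :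
    sgnFun A (transl A g v) = (if g.1 = 0 then 1 else -1) * sgnFun A v := by
  show sgn A ⬝ᵥ transl A g v = (if g.1 = 0 then 1 else -1) * (sgn A ⬝ᵥ v)
  rw [transl_eq_comp, dotProduct_comp_equiv_symm]
  have hc : (sgn A ∘ (twEquiv A g)) = (if g.1 = 0 then (1 : ℤ) else -1) • sgn A := by
    funext ψ
    show sgn A (tw A g ψ) = ((if g.1 = 0 then (1 : ℤ) else -1) • sgn A) ψ
    rw [Pi.smul_apply, smul_eq_mul, sgn_tw]
  rw [hc, smul_dotProduct, smul_eq_mul]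

omit [AddCommGroup A] in
/-- `sgnFun` of a face class, corner by corner. [folklore] -/
theorem sgnFun_faceVec (φ : Ty A) (i j : A) :
    sgnFun A (faceVec A φ i j) = sgn A φ + sgn A (φ + 1 + δ A i) + sgn A (φ + 1 + δ A j) + sgn A (φ + δ A i + δ A j) := by
  unfold faceVec
  rw [map_add, map_add, map_add, sgnFun_single, sgnFun_single, sgnFun_single, sgnFun_single]
  ring

omit [AddCommGroup A] in
/-- **`sgnFun` vanishes on the class of every face through two defects of a type of weight `< |A|/2`** (signs `+, −, −, +`).
[folklore] -/
theorem sgnFun_faceVec_eq_zero_of_lt {φ : Ty A} {i j : A} (hi : φ i = 1) (hj : φ j = 1) (hij : i ≠ j)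
    (hφ : 2 * wt A φ < Fintype.card A) : sgnFun A (faceVec A φ i j) = 0 := by
  have hw := wt_le A φ
  have h2φ : 2 ≤ wt A φ := by
    unfold wt
    exact Finset.one_lt_card_iff.mpr ⟨i, j, by simp [hi], by simp [hj], hij⟩
  rw [sgnFun_faceVec]
  unfold sgn
  rw [wt_corner_bar A hi, wt_corner_bar A hj, wt_corner_flip A hi hj hij]
  split_ifs <;> omega

omit [AddCommGroup A] in
/-- **`sgnFun` is `−1` on the class of a face through two defects of a type of weight exactly `|A|/2`** (signs `0, −, −, +`).
[folklore] -/
theorem sgnFun_faceVec_of_eq {φ : Ty A} {i j : A} (hi : φ i = 1) (hj : φ j = 1) (hij : i ≠ j)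
    (hφ : 2 * wt A φ = Fintype.card A) : sgnFun A (faceVec A φ i j) = -1 := by
  have hw := wt_le A φ
  have h2φ : 2 ≤ wt A φ := by
    unfold wt
    exact Finset.one_lt_card_iff.mpr ⟨i, j, by simp [hi], by simp [hj], hij⟩
  rw [sgnFun_faceVec]
  unfold sgn
  rw [wt_corner_bar A hi, wt_corner_bar A hj, wt_corner_flip A hi hj hij]
  split_ifs <;> omega

/-- `sgnFun` vanishes on `pairs ⊔` the translates of the canonical squares of weight `≤ K` whenever `2K < |A|`. [folklore] -/
theorem sgnFun_eq_zero_of_mem {K : ℕ} (hK : 2 * K < Fintype.card A) {v : Ty A → ℤ}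
    (hv : v ∈ pairs A ⊔ spanFaces A ((squares A).filter fun f => wt A f.1 ≤ K)) : sgnFun A v = 0 := by
  have hle : pairs A ⊔ spanFaces A ((squares A).filter fun f => wt A f.1 ≤ K) ≤ LinearMap.ker (sgnFun A) := by
    refine sup_le (Submodule.span_le.mpr ?_) (Submodule.span_le.mpr ?_)
    · rintro _ ⟨ψ, rfl⟩
      exact sgnFun_pairVec A ψ
    · rintro _ ⟨g, f, hf, rfl⟩
      obtain ⟨hf, hfK⟩ := Finset.mem_filter.mp hf
      obtain ⟨ω, hω, rfl⟩ := Finset.mem_image.mp hf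
      have h2 : 2 ≤ wt A (rep A ω) := by rw [wt_rep]; exact (Finset.mem_filter.mp hω).2
      obtain ⟨hij, hi, hj⟩ := pick_spec A h2
      have hlt : 2 * wt A (rep A ω) < Fintype.card A := by
        have : wt A (rep A ω) ≤ K := hfK
        omega
      show sgnFun A (transl A g (faceVec A (rep A ω) (pick A (rep A ω)).1 (pick A (rep A ω)).2)) = 0
      rw [sgnFun_transl, sgnFun_faceVec_eq_zero_of_lt A hi hj hij hlt, mul_zero]
  exact hle hv

omit [AddCommGroup A] in
/-- **`sgnFun weil = 2`** (`|A| ≥ 3`: the labels `0` and `δ s` are light). [folklore] -/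
theorem sgnFun_weil (h3 : 3 ≤ Fintype.card A) : sgnFun A (weil A) = 2 := by
  unfold weil
  rw [map_sub, map_sum, map_smul, sgnFun_single, smul_eq_mul]
  simp_rw [sgnFun_single]
  unfold sgn
  simp_rw [wt_delta, wt_zero]
  rw [if_pos (by omega : 2 * 1 < Fintype.card A), if_pos (by omega : 2 * 0 < Fintype.card A)]
  simp only [mul_one, Finset.sum_const, Finset.card_univ]
  ring

/-! ## §2 An anti-periodic type: `tw (0,t) ψ₀ = ψ₀ + 1` for an element `t` of order `2` -/

omit [DecidableEq A] in
/-- **An anti-periodic type exists** for every `t ≠ 0` with `t + t = 0`: order the elements of `A` and let `ψ₀ s = 0` iff `s` precedes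
`s + t`. [folklore] -/
theorem exists_antiperiodic {t : A} (ht0 : t ≠ 0) (htt : t + t = 0) : ∃ ψ : Ty A, tw A (0, t) ψ = ψ + 1 := by
  classical
  set e := Fintype.equivFin A with he
  refine ⟨fun s => if e s < e (s + t) then 0 else 1, ?_⟩
  funext s
  simp only [tw, Pi.add_apply, Pi.one_apply, add_zero]
  have hst : s + t + t = s := by rw [add_assoc, htt, add_zero]
  rw [hst]
  have hne : e s ≠ e (s + t) := fun h => ht0 (by
    have := e.injective h
    exact left_eq_add.mp this)
  rcases lt_or_gt_of_ne hne with h | h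
  · rw [if_pos h, if_neg (not_lt.mpr h.le)]
    decide
  · rw [if_neg (not_lt.mpr h.le), if_pos h]
    decide

omit [DecidableEq A] in
/-- `|A|` even ⇒ `A` has an element `t ≠ 0` with `t + t = 0` (Cauchy). [folklore] -/
theorem exists_add_self_eq_zero (hA : Even (Fintype.card A)) : ∃ t : A, t ≠ 0 ∧ t + t = 0 := by
  haveI : Fact (Nat.Prime 2) := ⟨Nat.prime_two⟩
  obtain ⟨t, ht⟩ := exists_prime_addOrderOf_dvd_card 2 (even_iff_two_dvd.mp hA)
  refine ⟨t, fun h => ?_, ?_⟩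
  · rw [h, addOrderOf_zero] at ht
    exact absurd ht (by decide)
  · rw [← two_nsmul, ← ht]
    exact addOrderOf_nsmul_eq_zero t

omit [DecidableEq A] in
/-- An anti-periodic type has weight exactly `|A|/2`. [folklore] -/
theorem two_mul_wt_of_antiperiodic {t : A} {ψ : Ty A} (h : tw A (0, t) ψ = ψ + 1) : 2 * wt A ψ = Fintype.card A := by
  have h1 : wt A (tw A (0, t) ψ) = wt A ψ := wt_tw_zero A t ψ
  rw [h, wt_add_one] at h1
  have := wt_le A ψ
  omega

omit [Fintype A] [DecidableEq A] in
/-- Twists of an anti-periodic type are anti-periodic. [folklore] -/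
theorem antiperiodic_tw {t : A} {ψ : Ty A} (h : tw A (0, t) ψ = ψ + 1) (g : ZMod 2 × A) :
    tw A (0, t) (tw A g ψ) = tw A g ψ + 1 := by
  rw [tw_tw, add_comm, ← tw_tw, h, tw_add_one]

/-! ## §3 The Weil vector lies in `pairs ⊔ ℤ[G]·squares` when `|A|` is even -/

/-- **The Weil vector is generated by the canonical squares modulo pairs** (`|A|` even, `≥ 4`). [folklore] -/
theorem weil_mem_of_even (hA : Even (Fintype.card A)) (h4 : 4 ≤ Fintype.card A) :
    weil A ∈ pairs A ⊔ spanFaces A (squares A) := by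
  -- (a) an anti-periodic normalised representative `ρ₀` with its canonical defects `i₀, j₀`
  obtain ⟨t, ht0, htt⟩ := exists_add_self_eq_zero A hA
  obtain ⟨ψ₀, hψ₀⟩ := exists_antiperiodic A ht0 htt
  have hwψ₀ := two_mul_wt_of_antiperiodic A hψ₀
  have hnc : ¬ ∀ y, ψ₀ y = ψ₀ 0 := nonconst_of_wt A (by omega) (by omega)
  set ω : OddDegreeParityLaw.OrbitsA A := Quotient.mk _ (⟨ψ₀, hnc⟩ : OddDegreeParityLaw.Nonconst A) with hω
  obtain ⟨g, hg⟩ := exists_tw_rep_eq A ⟨ψ₀, hnc⟩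
  set ρ₀ : Ty A := rep A ω with hρ₀def
  have hρ₀ : ρ₀ = tw A (-g) ψ₀ := by
    have hg' : tw A g ρ₀ = ψ₀ := hg
    rw [← hg', tw_neg_tw]
  have hanti : tw A (0, t) ρ₀ = ρ₀ + 1 := by rw [hρ₀]; exact antiperiodic_tw A hψ₀ (-g)
  have hwρ₀ : 2 * wt A ρ₀ = Fintype.card A := two_mul_wt_of_antiperiodic A hanti
  have hK2 : 2 ≤ wt A ρ₀ := by omega
  obtain ⟨hij, hi, hj⟩ := pick_spec A hK2
  set i₀ := (pick A ρ₀).1 with hi₀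
  set j₀ := (pick A ρ₀).2 with hj₀
  have hcls : 2 ≤ cls A ω := by rw [← wt_rep]; exact hK2
  -- (b) the canonical square `s` of `ω` and its `(0,t)`-translate `s'`
  have hsq : sqFace A ω ∈ squares A :=
    Finset.mem_image.mpr ⟨ω, Finset.mem_filter.mpr ⟨Finset.mem_univ _, hcls⟩, rfl⟩
  have hs : faceVec A ρ₀ i₀ j₀ ∈ spanFaces A (squares A) :=
    Submodule.subset_span ⟨0, sqFace A ω, hsq, by rw [transl_zero]; rfl⟩
  have hs' : faceVec A (ρ₀ + 1) (i₀ - t) (j₀ - t) ∈ spanFaces A (squares A) := by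
    refine Submodule.subset_span ⟨(0, t), sqFace A ω, hsq, ?_⟩
    show faceVec A (ρ₀ + 1) (i₀ - t) (j₀ - t) = transl A (0, t) (faceVec A ρ₀ i₀ j₀)
    rw [transl_faceVec, hanti]
  -- the conjugate type `ρ₀ + 1` has defects `i₀ − t`, `j₀ − t` and weight `|A|/2`
  have hχi : (ρ₀ + 1) (i₀ - t) = 1 := by
    rw [← hanti]; simp only [tw, sub_add_cancel, add_zero]; exact hi
  have hχj : (ρ₀ + 1) (j₀ - t) = 1 := by
    rw [← hanti]; simp only [tw, sub_add_cancel, add_zero]; exact hj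
  have hij' : i₀ - t ≠ j₀ - t := fun h => hij (sub_left_injective h)
  have hwχ : 2 * wt A (ρ₀ + 1) = Fintype.card A := by rw [wt_add_one]; have := wt_le A ρ₀; omega
  -- (c) `w = s + s' − pair(ρ₀)`: Hodge, supported in class `≤ |A|/2 − 1`
  set w : Ty A → ℤ := faceVec A ρ₀ i₀ j₀ + faceVec A (ρ₀ + 1) (i₀ - t) (j₀ - t) - pairVec A ρ₀ with hwdef
  have hw_eq : w = Pi.single (ρ₀ + 1 + δ A i₀) 1 + Pi.single (ρ₀ + 1 + δ A j₀) 1 + Pi.single (ρ₀ + δ A i₀ + δ A j₀) 1 +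
      (Pi.single (ρ₀ + 1 + 1 + δ A (i₀ - t)) 1 + Pi.single (ρ₀ + 1 + 1 + δ A (j₀ - t)) 1 +
        Pi.single (ρ₀ + 1 + δ A (i₀ - t) + δ A (j₀ - t)) 1) := by
    rw [hwdef]
    unfold faceVec pairVec
    abel
  have hwsupp : ∀ χ', w χ' ≠ 0 → clsTy A χ' ≤ Fintype.card A / 2 - 1 := by
    intro χ' hχ'
    have b1 := clsTy_corner_bar_le A hi
    have b2 := clsTy_corner_bar_le A hj
    have b3 := clsTy_corner_flip_le A hi hj hij
    have b4 := clsTy_corner_bar_le A hχi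
    have b5 := clsTy_corner_bar_le A hχj
    have b6 := clsTy_corner_flip_le A hχi hχj hij'
    by_contra hc
    apply hχ'
    rw [hw_eq]
    have n1 : χ' ≠ ρ₀ + 1 + δ A i₀ := by rintro rfl; omega
    have n2 : χ' ≠ ρ₀ + 1 + δ A j₀ := by rintro rfl; omega
    have n3 : χ' ≠ ρ₀ + δ A i₀ + δ A j₀ := by rintro rfl; omega
    have n4 : χ' ≠ ρ₀ + 1 + 1 + δ A (i₀ - t) := by rintro rfl; omega
    have n5 : χ' ≠ ρ₀ + 1 + 1 + δ A (j₀ - t) := by rintro rfl; omega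
    have n6 : χ' ≠ ρ₀ + 1 + δ A (i₀ - t) + δ A (j₀ - t) := by rintro rfl; omega
    simp only [Pi.add_apply, Pi.single_apply, if_neg n1, if_neg n2, if_neg n3, if_neg n4, if_neg n5, if_neg n6, add_zero]
  have hsub : pairs A ⊔ spanFaces A (squares A) ≤ hodge A := pairs_sup_spanFaces_squares_le_hodge A
  have hwH : w ∈ hodge A := by
    rw [hwdef]
    exact Submodule.sub_mem _ (Submodule.add_mem _ (faceVec_mem A _ hij) (faceVec_mem A _ hij')) (pairVec_mem A ρ₀)
  -- (d) descend `w` with class bound `|A|/2 − 1` and evaluate the sign functional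
  obtain ⟨r, hr, hdiff⟩ := exists_reduced_cls A (Fintype.card A / 2 - 1) w hwsupp
  have hlow : pairs A ⊔ spanFaces A ((squares A).filter fun f => wt A f.1 ≤ Fintype.card A / 2 - 1) ≤
      pairs A ⊔ spanFaces A (squares A) := sup_le_sup_left (spanFaces_mono A (Finset.filter_subset _ _)) _
  have hrH : r ∈ hodge A := by
    have : r = w - (w - r) := by abel
    rw [this]; exact Submodule.sub_mem _ hwH (hsub (hlow hdiff))
  have hreq := eq_smul_weil_of_wt_le_one A r hrH hr
  have hSw : sgnFun A w = -2 := by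
    rw [hwdef, map_sub, map_add, sgnFun_pairVec, sgnFun_faceVec_of_eq A hi hj hij hwρ₀,
      sgnFun_faceVec_of_eq A hχi hχj hij' hwχ]
    ring
  have hSdiff : sgnFun A (w - r) = 0 := sgnFun_eq_zero_of_mem A (by omega) hdiff
  rw [map_sub, hSw, hreq, map_smul, sgnFun_weil A (by omega), smul_eq_mul] at hSdiff
  have hρ : r (δ A 0) = -1 := by linarith
  rw [hρ, neg_one_smul] at hreq
  -- (e) `weil = −r = (w − r) − s − s' + pair(ρ₀)`
  have hweil : weil A = (w - r) - faceVec A ρ₀ i₀ j₀ - faceVec A (ρ₀ + 1) (i₀ - t) (j₀ - t) + pairVec A ρ₀ := by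
    rw [hreq, hwdef]; abel
  rw [hweil]
  refine Submodule.add_mem _ (Submodule.sub_mem _ (Submodule.sub_mem _ (hlow hdiff) (Submodule.mem_sup_right hs))
    (Submodule.mem_sup_right hs')) (Submodule.mem_sup_left (Submodule.subset_span ⟨ρ₀, rfl⟩))

/-- **`|A| = 2`** (a biquadratic CM field: `E₁ × E₂` and abelian surfaces): there is no canonical square and the Weil vector
`e_{δ 0} + e_{δ s}` IS the pair through `δ 0`. [folklore] -/
theorem weil_mem_pairs_of_card_eq_two (h2 : Fintype.card A = 2) : weil A ∈ pairs A := by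
  obtain ⟨x, y, hxy, huniv⟩ := Finset.card_eq_two.mp (show (univ : Finset A).card = 2 by rw [Finset.card_univ, h2])
  have hmem : ∀ a : A, a = x ∨ a = y := fun a => by
    have := Finset.mem_univ a
    rw [huniv, Finset.mem_insert, Finset.mem_singleton] at this
    exact this
  -- the non-zero element `s`, with `univ = {0, s}`
  obtain ⟨s, hs0, hs⟩ : ∃ s : A, s ≠ 0 ∧ ∀ a : A, a = 0 ∨ a = s := by
    rcases hmem 0 with h0 | h0
    · exact ⟨y, fun h => hxy (h0.symm.trans h.symm), fun a => (hmem a).imp (fun h => h.trans h0.symm) id⟩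
    · exact ⟨x, fun h => hxy (h.trans h0), fun a => (hmem a).symm.imp (fun h => h.trans h0.symm) id⟩
  have hδ : δ A s = δ A 0 + 1 := by
    funext a
    simp only [Pi.add_apply, Pi.one_apply, delta_apply]
    rcases hs a with rfl | rfl
    · rw [if_neg hs0.symm, if_pos rfl]; decide
    · rw [if_pos rfl, if_neg hs0]; decide
  have huniv' : (univ : Finset A) = {0, s} := by
    ext a
    simp only [Finset.mem_univ, Finset.mem_insert, Finset.mem_singleton, true_iff]
    exact hs a
  have hw : weil A = pairVec A (δ A 0) := by
    unfold weil pairVec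
    rw [huniv', Finset.sum_pair hs0.symm, h2, hδ]
    simp
  rw [hw]
  exact Submodule.subset_span ⟨δ A 0, rfl⟩

/-! ## §4 The theorem -/

/-- **THE THEOREM.**  For every finite abelian group `A` of EVEN order, the Hodge lattice of the faithful full slice of `(ℤ/2 × A, (1,0))`
is generated, together with the divisor pairs, by the Galois translates of the classes of the CANONICAL SQUARES alone — one rank-four
face per simple factor of defect class `≥ 2`; no closing face. [folklore] -/
theorem hodge_le_pairs_sup_spanFaces_squares_of_even (hA : Even (Fintype.card A)) :
    hodge A ≤ pairs A ⊔ spanFaces A (squares A) := by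
  have hweil : weil A ∈ pairs A ⊔ spanFaces A (squares A) := by
    have hpos : 0 < Fintype.card A := Fintype.card_pos
    obtain ⟨m, hm⟩ := hA
    by_cases h4 : 4 ≤ Fintype.card A
    · exact weil_mem_of_even A ⟨m, hm⟩ h4
    · exact Submodule.mem_sup_left (weil_mem_pairs_of_card_eq_two A (by omega))
  refine (hodge_le_pairs_sup_spanFaces_squares_sup_span_weil A).trans (sup_le le_rfl ?_)
  exact Submodule.span_le.mpr (Set.singleton_subset_iff.mpr hweil)

/-- The same in the `span` form consumed by the seat's odd-slice transport (`spanFaces` unfolded). [folklore] -/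
theorem hodge_le_pairs_sup_span_squares_of_even (hA : Even (Fintype.card A)) :
    hodge A ≤ pairs A ⊔
      Submodule.span ℤ {w : Ty A → ℤ | ∃ g : ZMod 2 × A, ∃ s ∈ squares A, w = transl A g (faceVec A s.1 s.2.1 s.2.2)} :=
  hodge_le_pairs_sup_spanFaces_squares_of_even A hA

/-! ## §5 The count: one square fewer than simple factors other than `E` -/

/-- **`|squares| + 1 = #OrbitsA A`** (`|A| > 1`, any parity): the canonical squares are indexed by the simple factors other than `E`
and other than the single-defect factor `B₁`. [folklore] -/
theorem card_squares_add_one (h1 : 1 < Fintype.card A) :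
    (squares A).card + 1 = Fintype.card (OddDegreeParityLaw.OrbitsA A) := by
  rw [squares_card]
  have hneg : (univ.filter fun ω : OddDegreeParityLaw.OrbitsA A => ¬ 2 ≤ cls A ω).card = 1 := by
    rw [Finset.card_eq_one]
    refine ⟨B1 A h1, ?_⟩
    ext ω
    simp only [Finset.mem_filter, Finset.mem_univ, true_and, Finset.mem_singleton, not_le]
    exact cls_lt_two_iff A h1 ω
  have h := Finset.card_filter_add_card_filter_not (s := (univ : Finset (OddDegreeParityLaw.OrbitsA A))) (fun ω => 2 ≤ cls A ω)
  rw [hneg, Finset.card_univ] at h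
  exact h

end Summit.HodgeConjecture.CorCM.Census.EvenSliceFacesGenerate
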